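import Summits.ValiantsHypothesis.ValiantsHypothesis.Theorems.KPlusLogSqLawTropicalShiftLadderDefs

/-!
# Route «KPlusLogSqLaw» — the explicit `K = (A+1)(E+1)` tropical family SHIFT-GRID: definitions

HONEST FRAMING.  Definitions-only file (D-0009) of a helper chain `--supports` the crux
`Summit.ValiantsHypothesis.ValiantsHypothesis.Theses.KPlusLogSqLaw.TropicalB` (ledger item `stmt-ValiantsHypothesis-19771`, route
`KPlusLogSqLaw`; object-search cell `pub-symmetroid`, seat val-sym-trop-p5 g8, 2026-08-27).  It names ONE explicit tropical design per format
`(m, (A+1)(E+1))`, `m = n + 1 ≥ 1`, `A, E ≥ 0`, in the tree's dominance vocabulary, the grid of its intended optima and the bookkeeping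
functions of the proof; nothing is proved here (the companion files `…TropicalShiftGrid.lean` / `…TropicalShiftGridChain.lean` prove that the
design has `(E·m+1)(A·m+1)` sign-alternating unique optima, whence `TropicalCensus.TropRootLawAt m ((A+1)(E+1)) B → (A·m+1)(E·m+1) − 1 ≤ B`,
and that this MEETS the rank-two GAP ceiling `KPlusLogSqLaw.Sumset.chain_succ_le_of_gap` for exponents `{a₁ + a₂·D : a₁ ≤ A, a₂ ≤ E}`: every
rank-two GAP exponent type is an exactly solved sector of the tropical census).  These are concrete witnesses, not notions: no statement of the
route depends on them.  Nothing here asserts `TropicalB`, `WeakLifting`, `KPlusLogSqLaw`, `MatrixDescartes` or anything about `VP ≠ VNP`; the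
family is quadratic in `m` for all `(A, E)` — the product ceiling `∏_j (m·A_j + 1)` is first open at rank three.

THE DESIGN (SHIFT-LADDER `…TropicalShiftLadderDefs.lean` = the case `E = 1`, whose constants `width`, `kap`, `bigD`, `pen`, `priceSum`,
`hsign`, `th`, `lvl`, `gval`, `bonus`, `grid` are reused verbatim).  Classes `l < (A+1)(E+1)` are read as a LOW RUNG `lo l = l mod (A+1) ∈ [0, A]`
and a HIGH DIGIT `hi l = l div (A+1) ∈ [0, E]`; exponents `d l = lo l + hi l · D` (`dd`).  FULL SUPPORT: every entry carries every class (`ee`),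
signed `lsign l = (−1)^{lo l} · hsign^{hi l}`.  The EFFECTIVE SHIFT of an incidence (`eshift`) is `shift + (hi − [wrap])·m`: in the gauge
`θ·κ·shift − θ·D·[wrap]` an incidence of high digit `h` on an entry of shift `q` scores like an entry of shift `q + (h − [wrap])·m`, so the phases
run through ALL of `p = 0 … E·m` — era `e = p div m` uses the rotation by `p mod m` with high digit `e` on its non-wrapping and `e + 1` on its
wrapping columns (`hlv`; entries are re-used across eras, each time at a larger exponent), and in each phase the `A·m` low rungs are climbed
round-robin (`ShiftLadder.lvl`).  Valuations (`vv`): `pen` at the effective shift plus `priceSum` of the low rungs; `lam`, `cterm` (rotation by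
`p mod m`, classes `lam p a`), `phi` (per-incidence score in the gauge).
-/

set_option linter.dupNamespace false
set_option autoImplicit false

namespace Summit.ValiantsHypothesis.ValiantsHypothesis.Theorems.LacunarySymmetroidMatrixDescartes.TropicalCensus

open Summit.ValiantsHypothesis.ValiantsHypothesis.Theorems.MatrixDescartes.Negative
open scoped BigOperators
open Finset

namespace ShiftGrid

open ShiftThree (shiftZ)
open ShiftSquare (rot)
open ShiftLadder (width kap bigD pen priceSum hsign th lvl gval bonus grid)

variable (A E n : ℕ)

/-- the low digit `l mod (A+1) ∈ [0, A]` of a class. -/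
def lo (l : Fin ((A + 1) * (E + 1))) : ℕ := (l : ℕ) % (A + 1)

/-- the high digit `l div (A+1) ∈ [0, E]` of a class. -/
def hi (l : Fin ((A + 1) * (E + 1))) : ℕ := (l : ℕ) / (A + 1)

/-- exponents `d l = lo l + hi l · D`: the rank-two generalized arithmetic progression `{j + h·D : j ≤ A, h ≤ E}`. -/
def dd (l : Fin ((A + 1) * (E + 1))) : ℕ := lo A E l + hi A E l * bigD A n

/-- EFFECTIVE SHIFT of an incidence: `shift + (high digit − [wrap])·m` — era `e` and rotation `q` give `q + e·m`. -/
def eshift (a b : Fin (n + 1)) (l : Fin ((A + 1) * (E + 1))) : ℤ :=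
  shiftZ n a b + ((hi A E l : ℤ) - (if (a : ℕ) < (b : ℕ) then 1 else 0)) * ((n : ℤ) + 1)

/-- valuations: penalty of the effective shift plus the cumulative price of the low rungs. -/
def vv : Fin (n + 1) → Fin (n + 1) → Fin ((A + 1) * (E + 1)) → ℤ := fun a b l =>
  pen A n (eshift A E n a b l) + priceSum A n (eshift A E n a b l) b (lo A E l)

/-- sign of a class: `(−1)^{lo l} · hsign^{hi l}`. -/
def lsign (l : Fin ((A + 1) * (E + 1))) : ℤ := (-1) ^ lo A E l * hsign A n ^ hi A E l

/-- presence/sign pattern: FULL support, every entry carries every class, signed by `lsign`. -/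
def ee : Fin (n + 1) → Fin (n + 1) → Fin ((A + 1) * (E + 1)) → ℤ := fun _ _ l => lsign A E n l

/-- the high digit of column `b` in phase `p`: the era `p div m`, plus one on the wrapping columns of the rotation `p mod m`. -/
def hlv (p : ℕ) (b : Fin (n + 1)) : ℕ := p / (n + 1) + (if n + 1 ≤ (b : ℕ) + p % (n + 1) then 1 else 0)

/-- the class map of the grid point `(p, a)` (digits capped so that the map is total). -/
def lam (p a : ℕ) : Fin (n + 1) → Fin ((A + 1) * (E + 1)) := fun b =>
  ⟨min A (lvl n a b) + (A + 1) * min E (hlv n p b), by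
    have h1 : min A (lvl n a b) ≤ A := min_le_left _ _
    have h2 : min E (hlv n p b) ≤ E := min_le_left _ _
    have h3 : (A + 1) * min E (hlv n p b) ≤ (A + 1) * E := Nat.mul_le_mul_left _ h2
    have h4 : (A + 1) * (E + 1) = (A + 1) * E + (A + 1) := by ring
    omega⟩

/-- the Leibniz term of the grid point `(p, a)`: rotation by `p mod m`, classes `lam p a`. -/
def cterm (p a : ℕ) : Equiv.Perm (Fin (n + 1)) × (Fin (n + 1) → Fin ((A + 1) * (E + 1))) :=
  (rot n (p % (n + 1)), lam A E n p a)

/-- per-incidence score in the zero-sum gauge `θ·κ·shift − θ·D·[wrap]`. -/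
def phi (θ : ℤ) (a b : Fin (n + 1)) (l : Fin ((A + 1) * (E + 1))) : ℤ :=
  θ * (dd A E n l : ℤ) - vv A E n a b l + θ * (kap A n : ℤ) * shiftZ n a b -
    θ * (bigD A n : ℤ) * (if (a : ℕ) < (b : ℕ) then 1 else 0)

end ShiftGrid

end Summit.ValiantsHypothesis.ValiantsHypothesis.Theorems.LacunarySymmetroidMatrixDescartes.TropicalCensus
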